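import Summits.Ventures.HodgeRepro2.T5SU11ResolventWeightedBasis

/-!
# The improper Green's operator is bounded on the exponentially weighted space, uniformly in the source

For `λ > 1` and a rate `ε` with `2 − λ < ε < λ`, the improper Green's solution `G^I_λ g` (row 492) of a source `g`
continuous on `(0, ∞)` with a GLOBAL bound `|g(s)| ≤ N e^{−εs}` satisfies `|G^I_λ g(t)| ≤ c N e^{−εt}` for every
`t > 0`, with a constant **`c = c(λ, ε)` independent of `g` and `N`** (`exists_abs_greenSolI_le_weighted`):
`G^I_λ` is a bounded operator of the weighted sup-norm `‖g‖_ε = sup_{s>0} |g(s)| e^{εs}`, with norm `≤ c`.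

* Away from the origin (`t ≥ 1`) this is the previous row (`abs_greenSolI_le_weighted_of_one_le`).
* Near the origin (`0 < t ≤ 1`): row 493's logarithmic bound `T_λ(t) ≤ T_λ(1) + (−log t)/(2m)` of `χ_λ = φ_λ T_λ`
  against `|B^I(t)| ≤ N Φ e^{|ε|} sinh 2 · t` and `−t log t ≤ 1`, and `|A^I(t)| ≤ N ∫_{(0,∞)} χ_λ e^{−εs} sinh 2s`
  (`abs_greenAI_le_integral_weighted`, `abs_greenSolI_le_of_le_one_weighted`), where the integral is a finite
  constant of `(λ, ε)` (row 496 applied to the source `e^{−εs}` itself).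

Nothing is claimed about (N).

Blind lane: Mathlib + the HodgeRepro2 prefix only; no sorry; axioms ⊆ {propext, Classical.choice,
Quot.sound}.
-/

namespace Summit.Ventures.HodgeRepro2.T5SU11ResolventWeightedBound

open Filter Topology MeasureTheory intervalIntegral
open Set (Ioi Ioc Icc)
open T5SU11Cartan T5SU11SphericalFunction T5SU11SphericalBounds T5SU11SphericalContinuous
  T5SU11SphericalSolutionSpaceAll T5SU11SphericalAsymptotic T5SU11SphericalCfun T5SU11SphericalDecay
  T5SU11SphericalDecayAsymptotic T5SU11SphericalDecayBracket T5SU11ResolventBoundary T5SU11ReductionOfOrder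
  T5SU11ReductionOfOrderInfinity T5SU11RadialGreenImproper T5SU11RadialGreenImproperOrigin
  T5SU11ResolventSourceIntegrable T5SU11RadialGreenImproperDecaySource T5SU11RadialGreenImproperStable
  T5SU11ResolventWeightedBasis

section measure

variable [MeasurableSpace Circle] [BorelSpace Circle]

variable {lam ε : ℝ} (hlam : 1 < lam) (hε₁ : 2 - lam < ε) (hε₂ : ε < lam)
  {g : ℝ → ℝ} (hg : ContinuousOn g (Ioi 0)) {N : ℝ} (hN0 : 0 ≤ N)
  (hN : ∀ s, 0 < s → |g s| ≤ N * Real.exp (-ε * s))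

/-! ### Near the origin -/

include hlam hε₁ hg hN0 hN in
/-- **`|A^I(t)| ≤ N ∫_{(0,∞)} χ_λ e^{−εs} sinh 2s`** for every `t > 0`. -/
theorem abs_greenAI_le_integral_weighted {t : ℝ} (ht : 0 < t) :
    |greenAI (sphDecay lam) g t| ≤ N * ∫ s in Ioi 0, sphDecay lam s * Real.exp (-ε * s) * Real.sinh (2 * s) := by
  have hA' : IntegrableOn (fun s => sphDecay lam s * g s * Real.sinh (2 * s)) (Ioi 0) :=
    integrableOn_sphDecay_mul_mul_sinh hlam hg (abs_le_of_weighted hN) (by positivity) hε₁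
      (abs_le_exp_of_weighted hN)
  have hI : IntegrableOn (fun s => sphDecay lam s * Real.exp (-ε * s) * Real.sinh (2 * s)) (Ioi 0) := by
    refine integrableOn_sphDecay_mul_mul_sinh hlam (g := fun s => Real.exp (-ε * s)) (C := 1) (s₀ := 0)
      (M := Real.exp |ε|) (by fun_prop) ?_ (Real.exp_pos _).le hε₁ ?_
    · intro s hs
      rw [abs_of_pos (Real.exp_pos _)]
      apply Real.exp_le_exp.mpr
      have h1 : -ε * s ≤ |ε| * s := mul_le_mul_of_nonneg_right (by rw [← abs_neg]; exact le_abs_self _) hs.1.le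
      have h2 : |ε| * s ≤ |ε| := by
        have := mul_le_mul_of_nonneg_left hs.2 (abs_nonneg ε)
        linarith
      linarith
    · intro s _
      rw [abs_of_pos (Real.exp_pos _), one_mul]
  calc |greenAI (sphDecay lam) g t|
      ≤ ∫ s in Ioi 0, |sphDecay lam s * g s * Real.sinh (2 * s)| := abs_greenAI_le hA' ht
    _ ≤ ∫ s in Ioi 0, N * (sphDecay lam s * Real.exp (-ε * s) * Real.sinh (2 * s)) := by
        apply setIntegral_mono_on hA'.abs (hI.const_mul N) measurableSet_Ioi
        intro s hs
        have hs0 : 0 < s := hs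
        have hsinh : 0 ≤ Real.sinh (2 * s) := Real.sinh_nonneg_iff.mpr (by linarith)
        have hχ0 : 0 < sphDecay lam s := sphDecay_pos hlam hs0
        rw [abs_mul, abs_mul, abs_of_pos hχ0, abs_of_nonneg hsinh]
        calc sphDecay lam s * |g s| * Real.sinh (2 * s)
            ≤ sphDecay lam s * (N * Real.exp (-ε * s)) * Real.sinh (2 * s) :=
              mul_le_mul_of_nonneg_right (mul_le_mul_of_nonneg_left (hN s hs0) hχ0.le) hsinh
          _ = N * (sphDecay lam s * Real.exp (-ε * s) * Real.sinh (2 * s)) := by ring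
    _ = N * ∫ s in Ioi 0, sphDecay lam s * Real.exp (-ε * s) * Real.sinh (2 * s) := integral_const_mul _ _

include hlam hε₁ hg hN0 hN in
/-- **The bound near the origin**: for `0 < t ≤ 1`,
`|G^I_λ g(t)| ≤ (Φ² e^{|ε|} sinh 2 (T_λ(1) + 1/(2m)) + Φ ∫_{(0,∞)} χ_λ e^{−εs} sinh 2s) · N`, where `φ_λ ≤ Φ` and
`φ_λ² ≥ m` on `[0, 1]` (row 493's logarithmic bound of `χ_λ` against `|B^I(t)| = O(t)`, and `−t log t ≤ 1`). -/
theorem abs_greenSolI_le_of_le_one_weighted {Φ m : ℝ} (hΦ0 : 0 < Φ)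
    (hΦ : ∀ s ∈ Icc (0 : ℝ) 1, sph lam (hyp s) ≤ Φ) (hm : 0 < m)
    (hmin : ∀ s ∈ Icc (0 : ℝ) 1, m ≤ sph lam (hyp s) ^ 2) {t : ℝ} (ht : 0 < t) (ht1 : t ≤ 1) :
    |greenSolI (fun t => sph lam (hyp t)) (sphDecay lam) g t|
      ≤ (Φ ^ 2 * Real.exp |ε| * Real.sinh 2 * (tailIntegral (fun t => sph lam (hyp t)) 1 + 1 / (2 * m))
          + Φ * ∫ s in Ioi 0, sphDecay lam s * Real.exp (-ε * s) * Real.sinh (2 * s)) * N := by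
  set T1 := tailIntegral (fun t => sph lam (hyp t)) 1 with hT1
  have hT1pos : 0 < T1 :=
    tailIntegral_pos (hφ_sph lam) (hpos_sph lam) (integrableOn_roIntegrand_sph hlam) one_pos
  set I₀ := ∫ s in Ioi 0, sphDecay lam s * Real.exp (-ε * s) * Real.sinh (2 * s) with hI₀
  have hB := abs_greenBI_le (abs_le_of_weighted hN) (by positivity : 0 ≤ N * Real.exp |ε|) hΦ hΦ0.le ht ht1
  have hT := tailIntegral_le_of_le_one hlam hm hmin ht ht1
  have hA := abs_greenAI_le_integral_weighted hlam hε₁ hg hN0 hN ht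
  have hχ : sphDecay lam t = sph lam (hyp t) * tailIntegral (fun t => sph lam (hyp t)) t := rfl
  have hφt : sph lam (hyp t) ≤ Φ := hΦ t ⟨ht.le, ht1⟩
  have hφ0 : 0 < sph lam (hyp t) := sph_hyp_pos lam t
  have hTpos : 0 < tailIntegral (fun t => sph lam (hyp t)) t :=
    tailIntegral_pos (hφ_sph lam) (hpos_sph lam) (integrableOn_roIntegrand_sph hlam) ht
  have hlog : -(t * Real.log t) ≤ 1 := neg_mul_log_le_one ht
  have hsinh2 : 0 < Real.sinh 2 := Real.sinh_pos_iff.mpr two_pos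
  have hexp : 0 < Real.exp |ε| := Real.exp_pos _
  -- the head term
  have h1 : sphDecay lam t * |greenBI (fun t => sph lam (hyp t)) g t|
      ≤ Φ ^ 2 * Real.exp |ε| * Real.sinh 2 * (T1 + 1 / (2 * m)) * N := by
    rw [hχ]
    calc sph lam (hyp t) * tailIntegral (fun t => sph lam (hyp t)) t * |greenBI (fun t => sph lam (hyp t)) g t|
        ≤ Φ * (T1 + (-Real.log t) / (2 * m)) * (Φ * (N * Real.exp |ε|) * Real.sinh 2 * t) := by
          apply mul_le_mul (mul_le_mul hφt hT hTpos.le hΦ0.le) hB (abs_nonneg _)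
          have : 0 ≤ T1 + (-Real.log t) / (2 * m) := le_trans hTpos.le hT
          positivity
      _ = Φ ^ 2 * Real.exp |ε| * Real.sinh 2 * N * (T1 * t + (-(t * Real.log t)) / (2 * m)) := by ring
      _ ≤ Φ ^ 2 * Real.exp |ε| * Real.sinh 2 * N * (T1 + 1 / (2 * m)) := by
          apply mul_le_mul_of_nonneg_left _ (by positivity)
          have ha : T1 * t ≤ T1 := by nlinarith
          have hb : (-(t * Real.log t)) / (2 * m) ≤ 1 / (2 * m) :=
            div_le_div_of_nonneg_right hlog (by positivity)
          linarith
      _ = Φ ^ 2 * Real.exp |ε| * Real.sinh 2 * (T1 + 1 / (2 * m)) * N := by ring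
  -- the tail term
  have h2 : sph lam (hyp t) * |greenAI (sphDecay lam) g t| ≤ Φ * I₀ * N := by
    calc sph lam (hyp t) * |greenAI (sphDecay lam) g t| ≤ Φ * (N * I₀) :=
          mul_le_mul hφt hA (abs_nonneg _) hΦ0.le
      _ = Φ * I₀ * N := by ring
  unfold greenSolI
  calc |-(sphDecay lam t * greenBI (fun t => sph lam (hyp t)) g t) - sph lam (hyp t) * greenAI (sphDecay lam) g t|
      ≤ |-(sphDecay lam t * greenBI (fun t => sph lam (hyp t)) g t)|
          + |sph lam (hyp t) * greenAI (sphDecay lam) g t| := abs_sub _ _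
    _ = sphDecay lam t * |greenBI (fun t => sph lam (hyp t)) g t|
          + sph lam (hyp t) * |greenAI (sphDecay lam) g t| := by
          rw [abs_neg, abs_mul, abs_mul, abs_of_pos (sphDecay_pos hlam ht), abs_of_pos hφ0]
    _ ≤ Φ ^ 2 * Real.exp |ε| * Real.sinh 2 * (T1 + 1 / (2 * m)) * N + Φ * I₀ * N := add_le_add h1 h2
    _ = (Φ ^ 2 * Real.exp |ε| * Real.sinh 2 * (T1 + 1 / (2 * m)) + Φ * I₀) * N := by ring

end measure

/-! ### The uniform bound -/

section uniform

variable [MeasurableSpace Circle] [BorelSpace Circle]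

/-- **THE IMPROPER GREEN'S OPERATOR IS BOUNDED ON THE WEIGHTED SPACE, UNIFORMLY IN THE SOURCE**: for `λ > 1` and
`2 − λ < ε < λ` there is `c = c(λ, ε)` such that every source `g` continuous on `(0, ∞)` with `|g(s)| ≤ N e^{−εs}`
satisfies `|G^I_λ g(t)| ≤ c N e^{−εt}` for all `t > 0`. -/
theorem exists_abs_greenSolI_le_weighted {lam ε : ℝ} (hlam : 1 < lam) (hε₁ : 2 - lam < ε) (hε₂ : ε < lam) :
    ∃ c : ℝ, 0 ≤ c ∧ ∀ (g : ℝ → ℝ) (N : ℝ), ContinuousOn g (Ioi 0) → 0 ≤ N →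
      (∀ s, 0 < s → |g s| ≤ N * Real.exp (-ε * s)) →
      ∀ t, 0 < t → |greenSolI (fun t => sph lam (hyp t)) (sphDecay lam) g t| ≤ c * N * Real.exp (-ε * t) := by
  obtain ⟨c₁, hc₁, hφ⟩ := exists_sph_hyp_le_exp hlam
  obtain ⟨c₂, hc₂, hχ⟩ := exists_sphDecay_le_exp hlam
  obtain ⟨Φ, hΦ0, hΦ⟩ := exists_sph_hyp_le lam
  obtain ⟨m, hm, hmin⟩ := exists_sph_hyp_sq_ge lam
  set T1 := tailIntegral (fun t => sph lam (hyp t)) 1 with hT1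
  have hT1pos : 0 < T1 :=
    tailIntegral_pos (hφ_sph lam) (hpos_sph lam) (integrableOn_roIntegrand_sph hlam) one_pos
  set I₀ := ∫ s in Ioi 0, sphDecay lam s * Real.exp (-ε * s) * Real.sinh (2 * s) with hI₀
  have hI₀0 : 0 ≤ I₀ := by
    apply setIntegral_nonneg measurableSet_Ioi
    intro s hs
    have hs0 : 0 < s := hs
    exact mul_nonneg (mul_nonneg (sphDecay_pos hlam hs0).le (Real.exp_pos _).le)
      (Real.sinh_nonneg_iff.mpr (by linarith))
  set c₀ := Φ ^ 2 * Real.exp |ε| * Real.sinh 2 * (T1 + 1 / (2 * m)) + Φ * I₀ with hc₀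
  have hsinh2 : 0 < Real.sinh 2 := Real.sinh_pos_iff.mpr two_pos
  have hc₀ : 0 ≤ c₀ := by positivity
  have hκ₁ : 0 < lam - ε := by linarith
  have hκ₂ : 0 < lam + ε - 2 := by linarith
  set c := c₀ * Real.exp |ε| + c₁ * c₂ * (1 / (2 * (lam - ε)) + 1 / (2 * (lam + ε - 2))) with hc
  refine ⟨c, by positivity, fun g N hg hN0 hN t ht => ?_⟩
  have hE : 0 < Real.exp (-ε * t) := Real.exp_pos _
  rcases le_or_gt t 1 with ht1 | ht1
  · -- near the origin: `|G^I g(t)| ≤ c₀ N ≤ c₀ e^{|ε|} N e^{−εt}`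
    have h := abs_greenSolI_le_of_le_one_weighted hlam hε₁ hg hN0 hN hΦ0 hΦ hm hmin ht ht1
    have h1 : 1 ≤ Real.exp |ε| * Real.exp (-ε * t) := by
      rw [← Real.exp_add]
      apply Real.one_le_exp
      have ha : -ε * t ≥ -(|ε| * t) := by
        rw [← neg_mul]
        have h0 : -|ε| ≤ -ε := by
          have := neg_abs_le (-ε)
          rwa [abs_neg] at this
        exact mul_le_mul_of_nonneg_right h0 ht.le
      have hb : |ε| * t ≤ |ε| := by
        have := mul_le_mul_of_nonneg_left ht1 (abs_nonneg ε)
        linarith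
      linarith
    calc |greenSolI (fun t => sph lam (hyp t)) (sphDecay lam) g t| ≤ c₀ * N := h
      _ = c₀ * N * 1 := (mul_one _).symm
      _ ≤ c₀ * N * (Real.exp |ε| * Real.exp (-ε * t)) := mul_le_mul_of_nonneg_left h1 (by positivity)
      _ = c₀ * Real.exp |ε| * N * Real.exp (-ε * t) := by ring
      _ ≤ c * N * Real.exp (-ε * t) := by
          apply mul_le_mul_of_nonneg_right _ hE.le
          apply mul_le_mul_of_nonneg_right _ hN0
          rw [hc]
          have : 0 ≤ c₁ * c₂ * (1 / (2 * (lam - ε)) + 1 / (2 * (lam + ε - 2))) := by positivity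
          linarith
  · -- away from the origin: part C
    have h := abs_greenSolI_le_weighted_of_one_le hlam hε₁ hε₂ hg hN0 hN hc₁ hc₂ hφ hχ ht1.le
    calc |greenSolI (fun t => sph lam (hyp t)) (sphDecay lam) g t|
        ≤ c₁ * c₂ * (1 / (2 * (lam - ε)) + 1 / (2 * (lam + ε - 2))) * N * Real.exp (-ε * t) := h
      _ ≤ c * N * Real.exp (-ε * t) := by
          apply mul_le_mul_of_nonneg_right _ hE.le
          apply mul_le_mul_of_nonneg_right _ hN0
          rw [hc]
          have : 0 ≤ c₀ * Real.exp |ε| := by positivity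
          linarith

end uniform

end Summit.Ventures.HodgeRepro2.T5SU11ResolventWeightedBound
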